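import Summits.Ventures.HodgeRepro2.T5SU11KernelCompositionDerivative
import Summits.Ventures.HodgeRepro2.T5SU11KernelHilbertIdentity
import Summits.Ventures.HodgeRepro2.T5SU11ResolventIterateCommute

/-!
# Hilbert's identity for the powers of the resolvent on `W_1`:
`(G^I_λ)ⁿ g − (G^I_{λ₂})ⁿ g = (μ − μ₂) Σ_{j<n} (G^I_λ)^{j+1} (G^I_{λ₂})^{n−j} g`

Row 558's difference recursion `D_{n+1} = G^I_λ D_n + (μ − μ₂) G^I_λ (G^I_{λ₂})^{n+1} g` for `D_n = (G^I_λ)ⁿ g − (G^I_{λ₂})ⁿ g`,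
unrolled with the finite additivity of the resolvent on `W_1`, is the telescoping identity
`A^n − B^n = (A − B) Σ_{j<n} A^j B^{n−1−j}` of two commuting operators with `A − B = (μ − μ₂) A B`:

* `greenSolI_zero_source`, `greenSolI_sum_range_ground` — **`G^I_λ (Σ_{j<n} h_j) = Σ_{j<n} G^I_λ h_j`** on `(0, ∞)` for sources
  `h_j ∈ W_1`;
* `iterate_sub_iterate_eq_sum` — **Hilbert's identity for the powers**
  `(G^I_λ)ⁿ g(t) − (G^I_{λ₂})ⁿ g(t) = (μ − μ₂) Σ_{j<n} (G^I_λ)^{j+1} (G^I_{λ₂})^{n−j} g(t)` for `g ∈ W_1`, `t > 0`;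
* `iterate_sub_iterate_eq_sum'` — the same with the mixed compositions in the other order (row 597's commutation);
* `kernel_comp_sub_eq` — **Hilbert's identity for the composed kernels**:
  `K_λ^{∘(n+1)}(t, s) − K_{λ₂}^{∘(n+1)}(t, s) = (μ − μ₂) (Σ_{j<n} (G^I_λ)^{j+1} (G^I_{λ₂})^{n−j} K_λ(·, s)(t) + (G^I_{λ₂})ⁿ G^I_λ K_{λ₂}(·, s)(t))`.

Nothing is claimed about (N).

Blind lane: Mathlib + the HodgeRepro2 prefix only; no sorry; axioms ⊆ {propext, Classical.choice,
Quot.sound}.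
-/

namespace Summit.Ventures.HodgeRepro2.T5SU11ResolventIterateHilbert

open Filter Topology MeasureTheory
open Set (Ioi Ioc)
open T5SU11Cartan T5SU11SphericalFunction T5SU11SphericalDecay T5SU11RadialGreenKernel T5SU11RadialGreenImproper
  T5SU11KernelDifferenceRegularity T5SU11KernelDerivative T5SU11WeightedSpaceGroundState
  T5SU11WeightedSpaceGroundStateOrder T5SU11WeightedSpaceGroundStateIterateDiff T5SU11KernelCompositionDerivative
  T5SU11KernelHilbertIdentity T5SU11ResolventIterateCommute

/-- The resolvent of the zero source vanishes. -/
theorem greenSolI_zero_source (φ χ : ℝ → ℝ) (t : ℝ) : greenSolI φ χ (fun _ => (0 : ℝ)) t = 0 := by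
  have h := greenSolI_const_mul_source φ χ (fun _ => (0 : ℝ)) 0 t
  simpa only [zero_mul] using h

section measure

variable [MeasurableSpace Circle] [BorelSpace Circle]

variable {lam : ℝ} (hlam : 1 < lam)

include hlam in
/-- **Finite additivity of the resolvent on `W_1`**: `G^I_λ (Σ_{j<n} h_j)(t) = Σ_{j<n} G^I_λ h_j(t)` for `t > 0` and sources
`h_j ∈ W_1`. -/
theorem greenSolI_sum_range_ground (h : ℕ → ℝ → ℝ) (hc : ∀ j, ContinuousOn (h j) (Ioi 0)) (D : ℕ → ℝ)
    (hD : ∀ j, ∀ r, 0 < r → |h j r| ≤ D j * sph 1 (hyp r)) (n : ℕ) {t : ℝ} (ht : 0 < t) :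
    greenSolI (fun t => sph lam (hyp t)) (sphDecay lam) (fun r => ∑ j ∈ Finset.range n, h j r) t
      = ∑ j ∈ Finset.range n, greenSolI (fun t => sph lam (hyp t)) (sphDecay lam) (h j) t := by
  induction n with
  | zero =>
    simp only [Finset.range_zero, Finset.sum_empty]
    exact greenSolI_zero_source _ _ t
  | succ n ih =>
    have hcs : ContinuousOn (fun r => ∑ j ∈ Finset.range n, h j r) (Ioi 0) :=
      continuousOn_finsetSum _ (fun j _ => hc j)
    have hDs : ∀ r, 0 < r → |∑ j ∈ Finset.range n, h j r| ≤ (∑ j ∈ Finset.range n, D j) * sph 1 (hyp r) := by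
      intro r hr
      calc |∑ j ∈ Finset.range n, h j r| ≤ ∑ j ∈ Finset.range n, |h j r| := Finset.abs_sum_le_sum_abs _ _
        _ ≤ ∑ j ∈ Finset.range n, D j * sph 1 (hyp r) := Finset.sum_le_sum (fun j _ => hD j r hr)
        _ = (∑ j ∈ Finset.range n, D j) * sph 1 (hyp r) := by rw [Finset.sum_mul]
    have e : (fun r => ∑ j ∈ Finset.range (n + 1), h j r) = fun r => (∑ j ∈ Finset.range n, h j r) + h n r := by
      funext r
      rw [Finset.sum_range_succ]
    rw [e, greenSolI_add_ground hlam hcs (hc n) hDs (hD n) ht, ih, Finset.sum_range_succ]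

variable {lam₂ : ℝ} (hlam₂ : 1 < lam₂)

section ground_state

variable {g : ℝ → ℝ} (hg : ContinuousOn g (Ioi 0)) {D : ℝ} (hD : ∀ s, 0 < s → |g s| ≤ D * sph 1 (hyp s))

include hlam hlam₂ hg hD in
/-- The mixed compositions `(G^I_λ)^{m} (G^I_{λ₂})^{k} g` lie in `W_1`, with the product of the sharp constants. -/
theorem mixed_iterate_mem_weighted_one (m k : ℕ) :
    ContinuousOn ((greenSolI (fun t => sph lam (hyp t)) (sphDecay lam))^[m]
        ((greenSolI (fun t => sph lam₂ (hyp t)) (sphDecay lam₂))^[k] g)) (Ioi 0) ∧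
      ∀ r, 0 < r → |((greenSolI (fun t => sph lam (hyp t)) (sphDecay lam))^[m]
          ((greenSolI (fun t => sph lam₂ (hyp t)) (sphDecay lam₂))^[k] g)) r|
        ≤ D / ((lam₂ - 1) ^ 2) ^ k / ((lam - 1) ^ 2) ^ m * sph 1 (hyp r) := by
  obtain ⟨hc₂, hb₂⟩ := iterate_mem_weighted_one hlam₂ hg hD k
  have hb₂' : ∀ s, 0 < s → |((greenSolI (fun t => sph lam₂ (hyp t)) (sphDecay lam₂))^[k] g) s|
      ≤ D / ((lam₂ - 1) ^ 2) ^ k * sph 1 (hyp s) := fun s hs => by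
    rw [div_mul_eq_mul_div]
    exact hb₂ s hs
  obtain ⟨hc, hb⟩ := iterate_mem_weighted_one hlam hc₂ hb₂' m
  refine ⟨hc, fun r hr => ?_⟩
  rw [div_mul_eq_mul_div]
  exact hb r hr

include hlam hlam₂ hg hD in
/-- **HILBERT'S IDENTITY FOR THE POWERS OF THE RESOLVENT ON `W_1`**:
`(G^I_λ)ⁿ g(t) − (G^I_{λ₂})ⁿ g(t) = (μ − μ₂) Σ_{j<n} (G^I_λ)^{j+1} (G^I_{λ₂})^{n−j} g(t)` for every `n` and `t > 0`. -/
theorem iterate_sub_iterate_eq_sum (n : ℕ) :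
    ∀ t, 0 < t → ((greenSolI (fun t => sph lam (hyp t)) (sphDecay lam))^[n] g) t
        - ((greenSolI (fun t => sph lam₂ (hyp t)) (sphDecay lam₂))^[n] g) t
      = (lam * (lam - 2) - lam₂ * (lam₂ - 2)) * ∑ j ∈ Finset.range n,
          ((greenSolI (fun t => sph lam (hyp t)) (sphDecay lam))^[j + 1]
            ((greenSolI (fun t => sph lam₂ (hyp t)) (sphDecay lam₂))^[n - j] g)) t := by
  induction n with
  | zero =>
    intro t _
    simp
  | succ n ih =>
    intro t ht
    rw [iterate_sub_succ hlam hlam₂ hg hD n ht]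
    -- the source `D_n` equals `(μ − μ₂) Σ_j …` on `(0, ∞)`
    have hsrc : ∀ r, 0 < r →
        ((greenSolI (fun t => sph lam (hyp t)) (sphDecay lam))^[n] g) r
            - ((greenSolI (fun t => sph lam₂ (hyp t)) (sphDecay lam₂))^[n] g) r
          = (lam * (lam - 2) - lam₂ * (lam₂ - 2)) * ∑ j ∈ Finset.range n,
              ((greenSolI (fun t => sph lam (hyp t)) (sphDecay lam))^[j + 1]
                ((greenSolI (fun t => sph lam₂ (hyp t)) (sphDecay lam₂))^[n - j] g)) r :=
      fun r hr => ih r hr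
    rw [greenSolI_congr_Ioi _ _ hsrc ht, greenSolI_const_mul_source]
    -- each mixed composition is in `W_1`
    have hc : ∀ j, ContinuousOn ((greenSolI (fun t => sph lam (hyp t)) (sphDecay lam))^[j + 1]
        ((greenSolI (fun t => sph lam₂ (hyp t)) (sphDecay lam₂))^[n - j] g)) (Ioi 0) :=
      fun j => (mixed_iterate_mem_weighted_one hlam hlam₂ hg hD (j + 1) (n - j)).1
    have hb : ∀ j, ∀ r, 0 < r → |((greenSolI (fun t => sph lam (hyp t)) (sphDecay lam))^[j + 1]
        ((greenSolI (fun t => sph lam₂ (hyp t)) (sphDecay lam₂))^[n - j] g)) r|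
        ≤ D / ((lam₂ - 1) ^ 2) ^ (n - j) / ((lam - 1) ^ 2) ^ (j + 1) * sph 1 (hyp r) :=
      fun j r hr => (mixed_iterate_mem_weighted_one hlam hlam₂ hg hD (j + 1) (n - j)).2 r hr
    rw [greenSolI_sum_range_ground hlam _ hc _ hb n ht]
    -- re-index the sum over `range (n + 1)`
    have e1 : ∀ j, greenSolI (fun t => sph lam (hyp t)) (sphDecay lam)
        ((greenSolI (fun t => sph lam (hyp t)) (sphDecay lam))^[j + 1]
          ((greenSolI (fun t => sph lam₂ (hyp t)) (sphDecay lam₂))^[n - j] g)) t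
        = ((greenSolI (fun t => sph lam (hyp t)) (sphDecay lam))^[j + 1 + 1]
          ((greenSolI (fun t => sph lam₂ (hyp t)) (sphDecay lam₂))^[n + 1 - (j + 1)] g)) t := by
      intro j
      rw [← Function.iterate_succ_apply' (greenSolI (fun t => sph lam (hyp t)) (sphDecay lam)) (j + 1),
        Nat.add_sub_add_right]
    rw [Finset.sum_range_succ', Finset.sum_congr rfl (fun j _ => e1 j)]
    simp only [zero_add, Nat.sub_zero, Function.iterate_one]
    ring

include hlam hlam₂ hg hD in
/-- Hilbert's identity for the powers with the mixed compositions in the other order (row 597's commutation):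
`(G^I_λ)ⁿ g(t) − (G^I_{λ₂})ⁿ g(t) = (μ − μ₂) Σ_{j<n} (G^I_{λ₂})^{n−j} (G^I_λ)^{j+1} g(t)`. -/
theorem iterate_sub_iterate_eq_sum' (n : ℕ) {t : ℝ} (ht : 0 < t) :
    ((greenSolI (fun t => sph lam (hyp t)) (sphDecay lam))^[n] g) t
        - ((greenSolI (fun t => sph lam₂ (hyp t)) (sphDecay lam₂))^[n] g) t
      = (lam * (lam - 2) - lam₂ * (lam₂ - 2)) * ∑ j ∈ Finset.range n,
          ((greenSolI (fun t => sph lam₂ (hyp t)) (sphDecay lam₂))^[n - j]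
            ((greenSolI (fun t => sph lam (hyp t)) (sphDecay lam))^[j + 1] g)) t := by
  rw [iterate_sub_iterate_eq_sum hlam hlam₂ hg hD n t ht]
  congr 1
  refine Finset.sum_congr rfl (fun j _ => ?_)
  exact iterate_iterate_comm hlam hlam₂ hg hD (j + 1) (n - j) t ht

end ground_state

section kernel

variable {s : ℝ} (hs : 0 < s)

include hlam hlam₂ hs in
/-- **The kernels at two spectral points differ by `(μ − μ₂) G^I_λ K_{λ₂}(·, s)`** on `(0, ∞)` (row 596 in resolvent form). -/
theorem kernel_sub_kernel_eq_greenSolI {r : ℝ} (hr : 0 < r) :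
    sphGreenKernel lam r s - sphGreenKernel lam₂ r s
      = (lam * (lam - 2) - lam₂ * (lam₂ - 2))
        * greenSolI (fun t => sph lam (hyp t)) (sphDecay lam) (fun u => sphGreenKernel lam₂ u s) r := by
  rw [kernel_hilbert_identity hlam hlam₂ hs hr, integral_kernel_mul_kernel_eq hlam hlam₂ hs hr]

include hlam hlam₂ hs in
/-- **HILBERT'S IDENTITY FOR THE COMPOSED KERNELS**:
`K_λ^{∘(n+1)}(t, s) − K_{λ₂}^{∘(n+1)}(t, s)
  = (μ − μ₂) (Σ_{j<n} (G^I_λ)^{j+1} (G^I_{λ₂})^{n−j} K_λ(·, s)(t) + (G^I_{λ₂})ⁿ (G^I_λ K_{λ₂}(·, s))(t))` for `t > 0`. -/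
theorem kernel_comp_sub_eq (n : ℕ) {t : ℝ} (ht : 0 < t) :
    ((greenSolI (fun t => sph lam (hyp t)) (sphDecay lam))^[n] (fun r => sphGreenKernel lam r s)) t
        - ((greenSolI (fun t => sph lam₂ (hyp t)) (sphDecay lam₂))^[n] (fun r => sphGreenKernel lam₂ r s)) t
      = (lam * (lam - 2) - lam₂ * (lam₂ - 2))
        * ((∑ j ∈ Finset.range n, ((greenSolI (fun t => sph lam (hyp t)) (sphDecay lam))^[j + 1]
            ((greenSolI (fun t => sph lam₂ (hyp t)) (sphDecay lam₂))^[n - j] (fun r => sphGreenKernel lam r s))) t)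
          + ((greenSolI (fun t => sph lam₂ (hyp t)) (sphDecay lam₂))^[n]
            (greenSolI (fun t => sph lam (hyp t)) (sphDecay lam) (fun u => sphGreenKernel lam₂ u s))) t) := by
  -- the two kernel sources lie in `W_1`
  obtain ⟨D₁, _, hD₁⟩ := kernel_source_mem_weighted_one hlam hs
  obtain ⟨D₂, _, hD₂⟩ := kernel_source_mem_weighted_one hlam₂ hs
  have hc₁ := kernel_source_continuousOn hlam hs
  have hc₂ := kernel_source_continuousOn hlam₂ hs
  -- split the difference through `(G^I_{λ₂})ⁿ K_λ(·, s)`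
  have h1 := iterate_sub_iterate_eq_sum hlam hlam₂ hc₁ hD₁ n t ht
  have h2 := iterate_sub_ground hlam₂ hc₁ hc₂ hD₁ hD₂ n t ht
  -- `(G^I_{λ₂})ⁿ (K_λ − K_{λ₂}) = (μ − μ₂) (G^I_{λ₂})ⁿ G^I_λ K_{λ₂}(·, s)` on `(0, ∞)`
  have h3 : ((greenSolI (fun t => sph lam₂ (hyp t)) (sphDecay lam₂))^[n]
        (fun r => sphGreenKernel lam r s - sphGreenKernel lam₂ r s)) t
      = (lam * (lam - 2) - lam₂ * (lam₂ - 2)) * ((greenSolI (fun t => sph lam₂ (hyp t)) (sphDecay lam₂))^[n]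
          (greenSolI (fun t => sph lam (hyp t)) (sphDecay lam) (fun u => sphGreenKernel lam₂ u s))) t := by
    rw [iterate_congr_Ioi (fun t => sph lam₂ (hyp t)) (sphDecay lam₂)
      (g := fun r => (lam * (lam - 2) - lam₂ * (lam₂ - 2))
        * greenSolI (fun t => sph lam (hyp t)) (sphDecay lam) (fun u => sphGreenKernel lam₂ u s) r)
      (fun r hr => kernel_sub_kernel_eq_greenSolI hlam hlam₂ hs hr) n t ht, iterate_const_mul]
  rw [h3] at h2
  linear_combination h1 - h2

end kernel

end measure

end Summit.Ventures.HodgeRepro2.T5SU11ResolventIterateHilbert
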